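import Summits.ResolutionOfSingularities.ResolutionOfSingularities.Theorems.EquisingularLiftEquisingularLiftNatTangentConeFibre
import Summits.ResolutionOfSingularities.ResolutionOfSingularities.Theorems.EquisingularLiftEquisingularLiftNatStrictTransformClosureCompl
import Literature.AlgebraicGeometry.Resolution.BlowupChartMembership
import Literature.AlgebraicGeometry.Resolution.RegularLocalRingsNormal
import HarnessLib

/-!
# [OURS · L1 W4.5(b) · EL♮] T-TCONE, part 4: from the (TC) clause's data to the cone hypothesis — «`¬ e ⊆ St(W)` ⇒ the local
# equation of `W` at `x` is non-zero, has an order `d ≥ 1` and an initial form `Φ̄ ≠ 0`» — crux `EquisingularLiftNat` = stmt-ResolutionOfSingularities-20038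

HONEST FRAMING. OURS (cell res-hironaka, crux chain w45b, slot W4.5(b)); NOT a statement of any manuscript; AI-written, weaker than
expert review. Helper `--supports stmt-ResolutionOfSingularities-20038 --as helper`; it closes nothing. Object = res-L1-w45b-lead-2's
T-TCONE item (3) «`¬ e ⊆ St W` ⟺ `in_d w ≠ 0` (automatic)» (STATUS 2026-08-27T08:06:58Z), in the direction the assembler of `HΔ(AdmTC)`
(res-D-pv-029, T-INST p515248) needs: the registered stub hands over `x ∈ W`, an affine `U₁ ∋ x` on which `𝓘(closure W)` is principal,
and `¬ (υ⁻¹{x} ⊆ closure υ⁻¹(W ∖ {x}))`; parts 1–3 (`…NatTangentConeFibre`, `…Reduced`, `…SquarefreeInitialForm`) want a form `Φ` of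
degree `d` with `𝓘(closure W)_x = (Φ(c))` and `Φ̄ ≠ 0`. This file is that bridge.

CONTENT (`υ : F' → F` a blow-up of the closed point `x`, i.e. `IsBlowup υ 𝓘_{x}`; `E = 𝓘_{x}·𝒪_{F'}`):
* `stalkIdeal_strictTransformIdeal_eq_bot_of_stalkIdeal_eq_bot` — for ANY blow-up `π` along `C` and ideal sheaf `K` with `K_{π x'} = 0`:
  `St(K)_{x'} = 0` (the exceptional ideal is an effective Cartier divisor, so `(0 : tⁿ) = 0`; no integrality needed).
* `preimage_singleton_subset_closure_of_stalkIdeal_eq_bot` — if `𝓘(closure W)_x = 0` (i.e. `W` is dense near `x`) then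
  `υ⁻¹{x} ⊆ closure υ⁻¹(W ∖ {x})` (part 1's support formula + res-L1-w45b-lead-2's `carrierTrace_eq_of_closure`, p514617); contrapositive
  `stalkIdeal_vanishingIdeal_closure_ne_bot` — **`¬ e ⊆ St(W)` ⇒ `𝓘(closure W)_x ≠ 0`**.
* `exists_isHomogeneous_of_isPrincipal` — **the cone data from the (TC) clause**: `𝒪_{F,x}` regular, `c` ANY system of generators of
  `𝔪_x` (the consumer's coordinates), `x ∈ W`, `𝓘(closure W)(U₁)` principal on an affine `U₁ ∋ x`, `¬ e ⊆ St(W)` ⟹ there are `d ≥ 1` and a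
  form `Φ ∈ 𝒪_{F,x}[T]` of degree `d` with `Φ̄ ≠ 0` in `κ(x)[T]` and `𝓘(closure W)_x = (Φ(c))` — exactly the hypotheses `hΦd`, `hΦ`, `hW`
  of parts 1–3 (the order `d` by Krull's intersection theorem, tree `exists_mem_pow_and_not_mem_pow_succ`; the form by part 1's
  `exists_isHomogeneous_of_stalkIdeal_eq_span`).

References: U. Görtz, T. Wedhorn, *Algebraic Geometry I* (2nd ed. 2020), (13.19) [GortzWedhorn2020]; O. Zariski, P. Samuel,
*Commutative Algebra* II, Ch. VIII §1 [ZariskiSamuel1960] — through the cited tree files; res-L1-w45b-lead-2 TARGET T-ISO-0⁺ (OURS).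
-/

set_option linter.dupNamespace false -- mandated namespace `Summit.<Summit>.<Problem>` of this single-conjunct summit

noncomputable section

open CategoryTheory AlgebraicGeometry TopologicalSpace Topology IsLocalRing
open Literature.AlgebraicGeometry.Resolution

namespace Summit.ResolutionOfSingularities.ResolutionOfSingularities.Cruxes.EquisingularLiftNat.Sections

universe u

/-! ## A strict transform of the zero germ is the zero germ -/

section General

variable {X X' : Scheme.{u}} {π : X' ⟶ X} {C : X.IdealSheafData}

/-- **`St(K)_{x'} = 0` when `K_{π x'} = 0`.** Along a blow-up the exceptional ideal `E = C·𝒪_{X'}` is an effective Cartier divisor, so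
its stalk is generated by a nonzerodivisor `t` and `(0 : tⁿ) = 0` for all `n`; hence the saturation `⋃ₙ (K·𝒪_{X'} : Eⁿ)` of the zero
ideal is zero. [cite: GortzWedhorn2020, (13.19) p. 413] -/
theorem stalkIdeal_strictTransformIdeal_eq_bot_of_stalkIdeal_eq_bot [IsLocallyNoetherian X'] (hπ : IsBlowup π C)
    (K : X.IdealSheafData) (x' : X')
    (hK : stalkIdeal K (π x') = ⊥) : stalkIdeal (strictTransformIdeal π C K) x' = ⊥ := by
  obtain ⟨t, ht, hE⟩ := hπ.isEffectiveCartier.exists_stalkIdeal_eq_span x'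
  rw [stalkIdeal_strictTransformIdeal, hK, Ideal.map_bot, hE]
  refine iSup_eq_bot.mpr fun n => ?_
  rw [Ideal.span_singleton_pow, eq_bot_iff]
  intro z hz
  have h := Submodule.mem_colon.mp hz (t ^ n) (Ideal.mem_span_singleton_self _)
  rw [smul_eq_mul, Submodule.mem_bot] at h
  exact (Submodule.mem_bot _).mpr ((mem_nonZeroDivisors_iff_right.mp (pow_mem ht n)) z h)

end General

/-! ## Point centres: `¬ e ⊆ St(W)` forces a non-zero local equation -/

section PointCentre

variable {F F' : Scheme.{u}} {υ : F' ⟶ F} {x : F} (hx : IsClosed ({x} : Set F))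

/-- **If `W` is dense near `x` (`𝓘(closure W)_x = 0`) the exceptional fibre lies in the strict transform**: `υ⁻¹{x} ⊆ closure υ⁻¹(W ∖ {x})`
for the blow-up `υ` of the closed point `x` (`F'` locally Noetherian). Indeed `St(𝓘_{closure W})_{x'} = 0` over `x`, so every point of
`e = υ⁻¹{x}` lies in `supp (St ⊔ E) = e ∩ closure υ⁻¹(closure W ∖ {x})` (part 1), and `closure υ⁻¹(closure W ∖ {x}) = closure υ⁻¹(W ∖ {x})`
(res-L1-w45b-lead-2, p514617). [folklore] -/
theorem preimage_singleton_subset_closure_of_stalkIdeal_eq_bot [IsLocallyNoetherian F']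
    (hυ : IsBlowup υ (Scheme.IdealSheafData.vanishingIdeal ⟨{x}, hx⟩)) (W : Set F)
    (hW : stalkIdeal (Scheme.IdealSheafData.vanishingIdeal ⟨closure W, isClosed_closure⟩) x = ⊥) :
    υ ⁻¹' {x} ⊆ closure (υ ⁻¹' (W \ {x})) := by
  set J := Scheme.IdealSheafData.vanishingIdeal (⟨{x}, hx⟩ : Closeds F) with hJ
  set K := Scheme.IdealSheafData.vanishingIdeal (⟨closure W, isClosed_closure⟩ : Closeds F) with hKdef
  rw [closure_preimage_diff_singleton_eq_of_isBlowup hx hυ W]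
  intro x' hx'
  have hxx : υ x' = x := hx'
  -- `x'` lies in `supp (St(K) ⊔ E) = υ⁻¹{x} ∩ closure υ⁻¹(closure W ∖ {x})`
  have hSt : stalkIdeal (strictTransformIdeal υ J K) x' = ⊥ :=
    stalkIdeal_strictTransformIdeal_eq_bot_of_stalkIdeal_eq_bot hυ K x' (by rw [hxx]; exact hW)
  have hE : x' ∈ (J.comap υ).support := by
    rw [Scheme.IdealSheafData.support_comap]
    show υ x' ∈ (J.support : Set F)
    rw [hJ, Scheme.IdealSheafData.coe_support_vanishingIdeal]
    exact hxx
  have hmem : x' ∈ (strictTransformIdeal υ J K ⊔ J.comap υ).support := by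
    rw [mem_support_iff_stalkIdeal_le, stalkIdeal_sup, hSt, bot_sup_eq, ← mem_support_iff_stalkIdeal_le]
    exact hE
  have hmem' : x' ∈ ((strictTransformIdeal υ J K ⊔ J.comap υ).support : Set F') := hmem
  rw [coe_support_strictTransformIdeal_sup_comap_vanishingIdeal hx (υ := υ) ⟨closure W, isClosed_closure⟩] at hmem'
  exact hmem'.2

/-- **`¬ e ⊆ St(W)` ⇒ `𝓘(closure W)_x ≠ 0`** (res-L1-w45b-lead-2's T-TCONE item (3), the direction T-INST uses). [folklore] -/
theorem stalkIdeal_vanishingIdeal_closure_ne_bot [IsLocallyNoetherian F']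
    (hυ : IsBlowup υ (Scheme.IdealSheafData.vanishingIdeal ⟨{x}, hx⟩)) (W : Set F)
    (hne : ¬ (υ ⁻¹' {x} ⊆ closure (υ ⁻¹' (W \ {x})))) :
    stalkIdeal (Scheme.IdealSheafData.vanishingIdeal ⟨closure W, isClosed_closure⟩) x ≠ ⊥ :=
  fun h => hne (preimage_singleton_subset_closure_of_stalkIdeal_eq_bot hx hυ W h)

/-- On an affine open `U ∋ x` where `I(U)` is principal, the stalk `I_x` is principal, generated by the germ of a generator. [folklore] -/
theorem exists_stalkIdeal_eq_span_of_isPrincipal (I : F.IdealSheafData) (U : F.affineOpens) (hxU : x ∈ (U : F.Opens))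
    (hI : (I.ideal U).IsPrincipal) : ∃ w : F.presheaf.stalk x, stalkIdeal I x = Ideal.span {w} := by
  obtain ⟨f, hf⟩ := hI
  refine ⟨(F.presheaf.germ U x hxU).hom f, ?_⟩
  rw [stalkIdeal_eq_map_germ I U hxU, hf]
  change Ideal.map _ (Ideal.span {f}) = _
  rw [Ideal.map_span, Set.image_singleton]

omit hx in
/-- A point of `supp I` has `I_x ⊆ 𝔪_x`; in particular a generator of a principal stalk lies in `𝔪_x`. [folklore] -/
theorem mem_maximalIdeal_of_stalkIdeal_eq_span {I : F.IdealSheafData} (hxI : x ∈ (I.support : Set F))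
    {w : F.presheaf.stalk x} (hw : stalkIdeal I x = Ideal.span {w}) : w ∈ maximalIdeal (F.presheaf.stalk x) := by
  have h := (mem_support_iff_stalkIdeal_le I x).mp hxI
  rw [hw, Ideal.span_singleton_le_iff_mem] at h
  exact h

/-- **The cone data from the (TC) clause.** Let `υ : F' → F` be the blow-up of the closed point `x` (`F'` locally Noetherian), `𝒪_{F,x}`
regular, `c` any system of generators of `𝔪_x`, `W ⊆ F` with `x ∈ W`, `U₁ ∋ x` an affine open on which `𝓘(closure W)` is principal, and
`¬ (υ⁻¹{x} ⊆ closure υ⁻¹(W ∖ {x}))`. Then for some `d ≥ 1` there is a form `Φ ∈ 𝒪_{F,x}[T]` of degree `d` with non-zero reduction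
`Φ̄ ∈ κ(x)[T]` (the initial form of the local equation) and `𝓘(closure W)_x = (Φ(c))` — the hypotheses of parts 1–3 of T-TCONE.
[cite: ZariskiSamuel1960, Ch. VIII §1 (1)] [cite: CossartPiltant2008, proof of Prop. 4.2, (10)] -/
theorem exists_isHomogeneous_of_isPrincipal [IsLocallyNoetherian F'] [IsRegularLocalRing (F.presheaf.stalk x)]
    (hυ : IsBlowup υ (Scheme.IdealSheafData.vanishingIdeal ⟨{x}, hx⟩)) {r : ℕ}
    (c : Fin r → F.presheaf.stalk x) (hc𝔪 : Ideal.span (Set.range c) = maximalIdeal (F.presheaf.stalk x))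
    (W : Set F) (hxW : x ∈ W) (U₁ : F.affineOpens) (hxU : x ∈ (U₁ : F.Opens))
    (hpr : ((Scheme.IdealSheafData.vanishingIdeal ⟨closure W, isClosed_closure⟩).ideal U₁).IsPrincipal)
    (hne : ¬ (υ ⁻¹' {x} ⊆ closure (υ ⁻¹' (W \ {x})))) :
    ∃ (d : ℕ) (Φ : MvPolynomial (Fin r) (F.presheaf.stalk x)), 0 < d ∧ Φ.IsHomogeneous d ∧
      MvPolynomial.map (Ideal.Quotient.mk (Ideal.span (Set.range c))) Φ ≠ 0 ∧
      stalkIdeal (Scheme.IdealSheafData.vanishingIdeal ⟨closure W, isClosed_closure⟩) x =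
        Ideal.span {MvPolynomial.eval c Φ} := by
  set K := Scheme.IdealSheafData.vanishingIdeal (⟨closure W, isClosed_closure⟩ : Closeds F) with hKdef
  obtain ⟨w, hw⟩ := exists_stalkIdeal_eq_span_of_isPrincipal K U₁ hxU hpr
  -- `w ≠ 0` by `¬ e ⊆ St(W)`, and `w ∈ 𝔪_x` since `x ∈ closure W`
  have hw0 : w ≠ 0 := by
    intro h
    apply stalkIdeal_vanishingIdeal_closure_ne_bot hx hυ W hne
    rw [← hKdef, hw, h, Ideal.span_singleton_eq_bot]
  have hxK : x ∈ (K.support : Set F) := by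
    rw [hKdef, Scheme.IdealSheafData.coe_support_vanishingIdeal]
    exact subset_closure hxW
  have hw𝔪 : w ∈ maximalIdeal (F.presheaf.stalk x) := mem_maximalIdeal_of_stalkIdeal_eq_span hxK hw
  -- the order `d` of `w` (Krull's intersection theorem) is positive
  obtain ⟨d, hwd, hwd'⟩ := exists_mem_pow_and_not_mem_pow_succ hw0
  have hd : 0 < d := by
    by_contra hd
    have hd0 : d = 0 := by omega
    rw [hd0, zero_add, pow_one] at hwd'
    exact hwd' hw𝔪
  obtain ⟨Φ, hΦd, -, hΦ, hKΦ⟩ := exists_isHomogeneous_of_stalkIdeal_eq_span c hc𝔪 K hw hwd hwd'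
  exact ⟨d, Φ, hd, hΦd, hΦ, hKΦ⟩

end PointCentre

end Summit.ResolutionOfSingularities.ResolutionOfSingularities.Cruxes.EquisingularLiftNat.Sections

end
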